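import Summits.FinalStateConjecture.FinalStateConjecture.Theses.ZeroEnergyKerrOrBomb
import Literature.Geometry.Lorentzian.TameGenericityDiagonal
import HarnessLib

/-!
# Line `wcc_relative_split` — crux `FinalStateFromKerrOrBomb` (stmt-FinalStateConjecture-17839, route ZeroEnergyKerrOrBomb rev 9)
# crux-strategist s1, 2026-08-17: the frame SPLIT AT WEAK COSMIC CENSORSHIP (two registered stubs, kernel-checked composition)

`FinalStateFromKerrOrBomb := KerrOrBombModT → FinalStateConjecture` from

* `stub_weakCosmicCensorshipTame` — VERBATIM the shared item `PhaseMixingCapture.WeakCosmicCensorshipTame`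
  (stmt-FinalStateConjecture-17269, staffed: `Cruxes/WeakCosmicCensorshipTame/`): tame-generically an MGHD exists and
  every MGHD has complete `𝓘⁺`.  X-free.
* `stub_finalStateRelCensorship` — THE CRUX RELATIVE TO CENSORSHIP: given X = `KerrOrBombModT`, along every tame curve
  of admissible data (immersed at `0` and injective, or constant) whose members off `0` are censored and whose base
  datum is exceptional for the summit property, a tame injective immersed curve of admissible data through the same
  base datum all of whose members off `0` satisfy the summit property (verbatim the lambda of `FinalStateConjecture`).
  Constant branch = censored exceptional data are curable (threshold data, data settling to a Killing-mode-UNSTABLE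
  hole, symmetric data); curve branch = a censorship-escape curve through an uncensored exceptional datum upgrades to a
  final-state-escape curve.  Given stub 1 it is EQUIVALENT to the crux (`finalStateRelCensorship_of_crux`), i.e. it
  is exactly "the crux minus WCC"; the live line `Lines/SketchIdeator1.lean` (m5) proves it with its stub 2′
  RESTRICTED to censored data (left disjunct `¬ SettlesDocWithT2 InTelescopeModT` now only for censored `D`) plus the
  curve branch, every other stub unchanged, X load-bearing at the dock of good members.

Composition = the tree's composition-of-genericities-along-curves lemma
`InitialDataSet.isTameChristodoulouGeneric_of_relative_exceptional` (TameGenericityDiagonal.lean): tame Christodoulou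
genericity is NOT closed under conjunction (`Theorems/CaptureSufficesTame/Negative/TameGenericityAndFails.lean`), so the
generic hypothesis WCC enters the generic conclusion ALONG ITS WITNESS CURVES, never pointwise — the corrected form of
the route header's TWO-LAYER PLAN chain "WeakCosmicCensorshipTame → SettlesToTelescopeClass → GenericityTransfer →
KerrChartTransferT2", which as a chain of generic statements would be decoration.  Route-level twin: `ledger route edit
… --split FinalStateFromKerrOrBomb --into WeakCosmicCensorshipTame FinalStateRelCensorshipFromKerrOrBomb`; Theses-free
glue for a prover to land verbatim: `WccSplitGlue.lean` (evidence on the item; `lean check` rc 0, axioms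
propext/Classical.choice/Quot.sound; δ-unfolding to the item shape verified).

Disproof used: `not_crux_iff` / `without_iff_summit` (no `_false_without_` exists short of `¬FSC`: nothing to honour);
§3 "X idles" is untouched (X rides as the antecedent of stub 2, consumed at the dock by whichever line proves it);
§5 `CruxPointwise` believed false — the strategist Sketch types its censored form `CruxPointwiseCensored` and proves
`crux_of_pointwiseCensored : CruxPointwiseCensored → WeakCosmicCensorshipTame → crux` (what pointwise rigidity would
buy: WCC by monotonicity), recording why X is too weak for it (a bomb hole's own development is censored, non-Kerr).
-/

set_option linter.dupNamespace false
set_option maxSynthPendingDepth 3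

noncomputable section

namespace Summit.FinalStateConjecture.FinalStateConjecture.Cruxes.FinalStateFromKerrOrBomb.WccRelativeSplit

open scoped BigOperators Topology Manifold Classical
open Filter Set Function TopologicalSpace
open Summit.FinalStateConjecture.FinalStateConjecture.Theses.ZeroEnergyKerrOrBomb

/-! ## §1 Stub statements (precise `Prop`s) -/

/-- **Stub 1 · `weakCosmicCensorshipTame`** — VERBATIM `PhaseMixingCapture.WeakCosmicCensorshipTame`
(stmt-FinalStateConjecture-17269): TAME weak cosmic censorship in MGHD form.  SIZE: open problem (Christodoulou 1999 in
spherical symmetry; vacuum naked singularities exist non-generically, RSR arXiv:1912.08478).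
(ref: Christodoulou1999, p. A24; DafermosLuk2017, §1.2.1) -/
def Sig.stub_weakCosmicCensorshipTame : Prop :=
  ∀ (X : Type) [TopologicalSpace X] [ChartedSpace Literature.Geometry.Lorentzian.E3 X] [IsManifold (𝓡 3) ((⊤ : ℕ∞) : WithTop ℕ∞) X] [T2Space X] [SecondCountableTopology X] [ConnectedSpace X], Literature.Geometry.Lorentzian.InitialDataSet.IsTameChristodoulouGeneric (Literature.Geometry.Lorentzian.admissibleVacuumData X) (fun D ↦ (∃ 𝒟 : Literature.Geometry.Lorentzian.VacuumCauchyDevelopment D, 𝒟.IsMaximal) ∧ ∀ 𝒟 : Literature.Geometry.Lorentzian.VacuumCauchyDevelopment D, 𝒟.IsMaximal → Summit.FinalStateConjecture.HasCompleteNullInfinity 𝒟.toCauchyDevelopment) 1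

/-- **Stub 2 · `finalStateRelCensorship`** — the crux RELATIVE TO CENSORSHIP (exceptional-base hand-back of
summit-good curves along censored curves), X = `KerrOrBombModT` kept as antecedent.  SIZE: open problem (large-data
settling of censored generic exteriors + generic third law + genericity transfer at Killing-mode-unstable limits +
the dock + T2 chart transfer = the live line m5 minus its uncensored case).  (ref: DafermosLuk2017, Conjecture 1 and
§1.2.1; Christodoulou1999, p. A24) -/
def Sig.stub_finalStateRelCensorship : Prop :=
  KerrOrBombModT → ∀ (X : Type) [TopologicalSpace X] [ChartedSpace Literature.Geometry.Lorentzian.E3 X] [IsManifold (𝓡 3) ((⊤ : ℕ∞) : WithTop ℕ∞) X] [T2Space X] [SecondCountableTopology X] [ConnectedSpace X], ∀ (e : Literature.Geometry.Lorentzian.AFEnd X) (F : EuclideanSpace ℝ (Fin 1) → Literature.Geometry.Lorentzian.InitialDataSet (𝓡 3) X), Literature.Geometry.Lorentzian.InitialDataSet.IsTameDataFamily e 1 F → ((Literature.Geometry.Lorentzian.InitialDataSet.IsImmersedAtZero 1 F ∧ Function.Injective F) ∨ ∀ c, F c = F 0) → (∀ c, F c ∈ Literature.Geometry.Lorentzian.admissibleVacuumData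 X) → (∀ c ≠ 0, (∃ 𝒟 : Literature.Geometry.Lorentzian.VacuumCauchyDevelopment (F c), 𝒟.IsMaximal) ∧ ∀ 𝒟 : Literature.Geometry.Lorentzian.VacuumCauchyDevelopment (F c), 𝒟.IsMaximal → Summit.FinalStateConjecture.HasCompleteNullInfinity 𝒟.toCauchyDevelopment) → ¬ ((∃ 𝒟 : Literature.Geometry.Lorentzian.VacuumCauchyDevelopment (F 0), 𝒟.IsMaximal) ∧ ∀ 𝒟 : Literature.Geometry.Lorentzian.VacuumCauchyDevelopment (F 0), 𝒟.IsMaximal → Summit.FinalStateConjecture.HasCompleteNullInfinity 𝒟.toCauchyDevelopment ∧ ∃ (O : Set 𝒟.carrier) (d : Literature.Geometry.Lorentzian.FinalStateDecomposition 𝒟.toSpacetime O 2), (∀ i, Literature.Geometry.Lorentzian.Kerr.IsSubextremal (d.mass i) (d.spin i)) ∧ O = Summit.FinalStateConjecture.exteriorOf 𝒟.toCauchyDevelopment d.charted ∧ Summit.FinalStateConjecture.RaysStayInClosure 𝒟.toCauchyDevelopment O ∧ Summit.FinalStateConjecture.HasExhaustiveCharts d ∧ Summit.FinalStateConjecture.IsFutureOriented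 d) → ∃ (e' : Literature.Geometry.Lorentzian.AFEnd X) (F' : EuclideanSpace ℝ (Fin 1) → Literature.Geometry.Lorentzian.InitialDataSet (𝓡 3) X), Literature.Geometry.Lorentzian.InitialDataSet.IsTameDataFamily e' 1 F' ∧ F' 0 = F 0 ∧ Function.Injective F' ∧ Literature.Geometry.Lorentzian.InitialDataSet.IsImmersedAtZero 1 F' ∧ (∀ c, F' c ∈ Literature.Geometry.Lorentzian.admissibleVacuumData X) ∧ ∀ c ≠ 0, (∃ 𝒟 : Literature.Geometry.Lorentzian.VacuumCauchyDevelopment (F' c), 𝒟.IsMaximal) ∧ ∀ 𝒟 : Literature.Geometry.Lorentzian.VacuumCauchyDevelopment (F' c), 𝒟.IsMaximal → Summit.FinalStateConjecture.HasCompleteNullInfinity 𝒟.toCauchyDevelopment ∧ ∃ (O : Set 𝒟.carrier) (d : Literature.Geometry.Lorentzian.FinalStateDecomposition 𝒟.toSpacetime O 2), (∀ i, Literature.Geometry.Lorentzian.Kerr.IsSubextremal (d.mass i) (d.spin i)) ∧ O = Summit.FinalStateConjecture.exteriorOf 𝒟.toCauchyDevelopment d.charted ∧ Summit.FinalStateConjecture.RaysStayInClosure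 𝒟.toCauchyDevelopment O ∧ Summit.FinalStateConjecture.HasExhaustiveCharts d ∧ Summit.FinalStateConjecture.IsFutureOriented d

/-! ## §2 Registered stubs (`sorry` lives ONLY here) -/

/-- Stub 1 (X-free, SHARED with stmt-17269): tame weak cosmic censorship, MGHD form. -/
theorem stub_weakCosmicCensorshipTame : Sig.stub_weakCosmicCensorshipTame := by
  sorry

/-- Stub 2 (the residual crux, relative to censorship; the live line's stubs prove it). -/
theorem stub_finalStateRelCensorship : Sig.stub_finalStateRelCensorship := by
  sorry

/-! ## §3 Composition (kernel-checked; concludes the crux BY NAME) -/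

/-- **`FinalStateFromKerrOrBomb_of`** — the crux from the two stubs: generic hypotheses enter generic conclusions
along curves (`InitialDataSet.isTameChristodoulouGeneric_of_relative_exceptional`); every admissible datum has a sole
strongly asymptotically flat end by definition of `admissibleVacuumData`. -/
theorem FinalStateFromKerrOrBomb_of
    (h₁ : Sig.stub_weakCosmicCensorshipTame) (h₂ : Sig.stub_finalStateRelCensorship) :
    Summit.FinalStateConjecture.FinalStateConjecture.Theses.ZeroEnergyKerrOrBomb.FinalStateFromKerrOrBomb := by
  intro hX X _ _ _ _ _ _
  refine Literature.Geometry.Lorentzian.InitialDataSet.isTameChristodoulouGeneric_of_relative_exceptional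
    ?_ (h₁ X) (h₂ hX X)
  intro d hd
  obtain ⟨-, e, M, hsole, hdecay⟩ := id hd
  exact ⟨e, hsole, M, hdecay⟩

/-- **Lossless**: the crux gives stub 2 back (the relative form with exceptional base is tame genericity read at the
base datum, `exists_curve_of_isTameChristodoulouGeneric_of_not`) — so, given stub 1, stub 2 ↔ crux. -/
theorem finalStateRelCensorship_of_crux
    (h : Summit.FinalStateConjecture.FinalStateConjecture.Theses.ZeroEnergyKerrOrBomb.FinalStateFromKerrOrBomb) :
    Sig.stub_finalStateRelCensorship := by
  intro hX X _ _ _ _ _ _ e F hF hdich hadm hQ hexc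
  exact Literature.Geometry.Lorentzian.InitialDataSet.exists_curve_of_isTameChristodoulouGeneric_of_not
    (Q := fun D ↦ (∃ 𝒟 : Literature.Geometry.Lorentzian.VacuumCauchyDevelopment D, 𝒟.IsMaximal) ∧
      ∀ 𝒟 : Literature.Geometry.Lorentzian.VacuumCauchyDevelopment D, 𝒟.IsMaximal →
        Summit.FinalStateConjecture.HasCompleteNullInfinity 𝒟.toCauchyDevelopment)
    (h hX X) e F hF hdich hadm hQ hexc

end Summit.FinalStateConjecture.FinalStateConjecture.Cruxes.FinalStateFromKerrOrBomb.WccRelativeSplit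

end
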